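import Summits.Ventures.YMGap.Thresholds.StarLimitPlaquette
import Summits.Ventures.YMGap.Thresholds.StarWindowBoundLemmaG
import HarnessLib

/-!
# Venture YMGap — track (c) «DS»: every infinite-volume limit state of `SU(2)` lattice Yang–Mills (`d = 4`,
# Wilson) is massive at every `0 ≤ β_W ≤ 9/25`, and its plaquette–plaquette correlation function decays
# exponentially — HYPOTHESIS-FREE rows (Lemma G is in the tree)

HONEST FRAMING: venture file (cell `pub-ymgap`, PLAN R99/R101–R103/R108), strong-coupling LATTICE statement only:
composition of the Lemma-G-conditional rows of `StarLimitStates.lean` / `StarLimitPlaquette.lean` (ds-2) with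
ds-4's kernel theorem `StarLemmaG.starWindowBound_lemmaG` (the gauge-fixed star window bound on every torus of
side `≥ 3` at every `0 ≤ β_W ≤ 1/2`, received sum `R_G(β_W)`; `R_G(9/25) = 2943/2957 < 1`,
`R_G < 1` iff `β_W < (√37 − 5)/3 = 0.3609…`).  The statements quantify over infinite-volume LIMIT STATES
(`infiniteVolumeLimitPoints`: subsequential weak limits of the torus Wilson states; non-empty by compactness,
`infiniteVolumeLimitPoints_nonempty_holds`).  Nothing about uniqueness of the DLR state (ds-1's line), the
continuum, confinement or a transfer-matrix gap.
-/

noncomputable section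

open MeasureTheory
open Literature.Probability.LatticeModels
open Literature.MathematicalPhysics.QuantumLattice (fundamentalRep infiniteVolumeLimitPoints plaquetteCorrFn)
open Literature.MathematicalPhysics.QuantumFieldTheory
open Literature.Barriers.QuantumFields (IsMassiveState)
open Summit.Ventures.YMGap.DSWindow
open Summit.Ventures.YMGap.StarWindowGauge (gaugeR)

namespace Summit.Ventures.YMGap.StarLimit

/-- **The schema, hypothesis-free**: for every threshold `β₀ ≤ 1/2` with `R_G(β₀) < 1` (equivalently
`β₀ < (√37 − 5)/3`), every infinite-volume limit state of `SU(2)` lattice Yang–Mills (`d = 4`, Wilson, tree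
coupling `β_W/2`) at every `0 ≤ β_W ≤ β₀` is massive, with the one rate `κ(R_G(β₀))`. -/
theorem su2_isMassiveState_of_gaugeR_lt_one (β₀ : ℝ) (hhalf : β₀ ≤ 1 / 2) (hρ : gaugeR β₀ < 1)
    {βW : ℝ} (hβ0 : 0 ≤ βW) (hβ1 : βW ≤ β₀) :
    ∀ μ ∈ infiniteVolumeLimitPoints (d := 4) (fundamentalRep (Fin 2)) (βW / 2), IsMassiveState μ :=
  su2_isMassiveState_of_lemmaG β₀ (hβ0.trans hβ1) (hhalf.trans (by norm_num)) hρ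
    (fun _ _ hL _ h0 h1 => StarLemmaG.starWindowBound_lemmaG hL h0 (h1.trans hhalf)) hβ0 hβ1

/-- **Every infinite-volume limit state of `SU(2)` lattice Yang–Mills (`d = 4`, Wilson action) at
`0 ≤ β_W ≤ 9/25` is massive** (NO hypothesis): for every subsequential limit `μ` of the torus Wilson states
at tree coupling `β_W/2` and all bounded measurable local observables `F₁, F₂` of `ℤ⁴`,
`|cov_μ(F₁, F₂ ∘ θ_x)| ≤ C(F₁, F₂) e^{−κ ‖x‖_∞}` with the one rate `κ = starRate (R_G(9/25)) > 0`
(`IsMassiveState μ`).  Lemma G (`StarLemmaG.starWindowBound_lemmaG`, ds-4) feeds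
`su2_isMassiveState_le_9_25_of_lemmaG` (ds-2). -/
theorem su2_isMassiveState_le_9_25 {βW : ℝ} (hβ0 : 0 ≤ βW) (hβ1 : βW ≤ 9 / 25) :
    ∀ μ ∈ infiniteVolumeLimitPoints (d := 4) (fundamentalRep (Fin 2)) (βW / 2), IsMassiveState μ :=
  su2_isMassiveState_le_9_25_of_lemmaG
    (fun _ _ hL _ h0 h1 => StarLemmaG.starWindowBound_lemmaG hL h0 (h1.trans (by norm_num))) hβ0 hβ1

/-- **Exponential decay of the plaquette–plaquette correlation function** (NO hypothesis) in every
infinite-volume limit state of `SU(2)` lattice Yang–Mills, `d = 4`, Wilson action, at every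
`0 ≤ β_W ≤ 9/25`: `plaquetteCorrFn (fundamentalRep (Fin 2)) μ` (Chatterjee's `f_β`; the operational
mass-gap criterion of Montvay–Münster §3.4.5) satisfies `HasExponentialDecay`. -/
theorem su2_hasExponentialDecay_plaquetteCorrFn_le_9_25 {βW : ℝ} (hβ0 : 0 ≤ βW) (hβ1 : βW ≤ 9 / 25) :
    ∀ μ ∈ infiniteVolumeLimitPoints (d := 4) (fundamentalRep (Fin 2)) (βW / 2),
      HasExponentialDecay (plaquetteCorrFn (fundamentalRep (Fin 2)) μ) :=
  fun μ hμ => hasExponentialDecay_plaquetteCorrFn_of_isMassiveState hμ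
    (su2_isMassiveState_le_9_25 hβ0 hβ1 μ hμ)

end Summit.Ventures.YMGap.StarLimit

end
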